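import Summits.ValiantsHypothesis.ValiantsHypothesis.Theses.AnyonJets
import Summits.ValiantsHypothesis.ValiantsHypothesis.Theorems.FermionicJetPencilControlsHC
import Literature.Computability.AlgebraicComplexity.RazElusiveGeneralRouteProofs

/-!
# Route `AnyonJets`, support item `TranscendentalFibre` (stmt-ValiantsHypothesis-16748) — PROVED

**Item (card P3, the fibre criterion, nontrivial direction).** For a TRANSCENDENTAL `z ∈ ℂ`: if the
`z`-fibre of the inversion pencil, `P_n(z; X) = ∑_σ z^{inv σ} ∏ᵢ X_{σ i, i}`, is a `VP` family, then so
is the permanent (`= P_n(1; X)`).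

**Proof (a Galois-theoretic shortcut replacing the card's constructibility argument).**
1. `Complex.exists_ringHom_apply_eq_of_transcendental`: the ring endomorphisms of `ℂ` act
   transitively on transcendental numbers — extend `{z}` and `{z'}` to transcendence bases of `ℂ/ℚ`
   (`exists_isTranscendenceBasis_superset`), which are equipotent
   (`IsTranscendenceBasis.cardinalMk_eq`); compose any bijection with a transposition so that
   `z ↦ z'`, and extend the induced isomorphism of the purely transcendental subalgebras to the
   algebraic closure `ℂ` (`IsAlgClosure.equivOfEquiv`, as in Mathlib's
   `IsAlgClosed.equivOfTranscendenceBasis`).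
2. Mapping a circuit along a ring endomorphism is free (`ArithCircuit.complexity_map_le`), and
   `φ(P_n(z; X)) = P_n(φ z; X)`; so every fibre `P_n(z + u; X)`, `u ∈ ℕ` (all transcendental), has
   complexity `≤ L(P_n(z; X))` (`complexity_fibre_add_nat_le`).
3. Interpolation: `u ↦ P_n(z + u; X)` is the node evaluation at `u = 0, …, D` (`D = n(n-1)/2 ≥`
   the `u`-degree) of the polynomial `∑_σ (z + u)^{inv σ} x^σ ∈ ℂ[X][u]`, whose value at `u = 1 - z`
   is `per_n`; a value of a degree-`≤ D` polynomial is a fixed linear combination of its values at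
   `D + 1` nodes (`aeval_optionElim_eq_sum_smul_nodes`, from the tree's inverse-Vandermonde lemma
   `exists_interpolation_weights`), so `L(per_n) ≤ (D+1)(L(P_n(z;X)) + 1) + (D+1)`
   (`complexity_perPoly_le_of_fibre`), p-bounded when `L(P_n(z; X))` is.
HONEST FRAMING: a structural equivalence step inside a dormant route (VH ⟺ hardness of a
transcendental anyon fibre needs this direction); nothing here bears on `VP ≠ VNP`, NOT proved.

References: L. G. Valiant, STOC 1979 (per); P. Bürgisser, *Completeness and Reduction in Algebraic
Complexity Theory*, 2000, §2.1, §4.1 (extension of scalars, interpolation); J.-T. Hung, C.-E. Kuo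
2023 (the inversion pencil); Mathlib `IsAlgClosed.equivOfTranscendenceBasis` (Steinitz).
-/

noncomputable section

open MvPolynomial Cardinal

/-- **Ring endomorphisms of `ℂ` act transitively on transcendental numbers** (Steinitz): for
transcendental `z, z'` there is `φ : ℂ →+* ℂ` with `φ z = z'`. [folklore] -/
theorem Complex.exists_ringHom_apply_eq_of_transcendental {z z' : ℂ}
    (hz : Transcendental ℚ z) (hz' : Transcendental ℚ z') :
    ∃ φ : ℂ →+* ℂ, φ z = z' := by
  classical
  have hi : AlgebraicIndepOn ℚ id ({z} : Set ℂ) :=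
    (algebraicIndependent_singleton_iff (⟨z, rfl⟩ : ({z} : Set ℂ))).2 hz
  have hi' : AlgebraicIndepOn ℚ id ({z'} : Set ℂ) :=
    (algebraicIndependent_singleton_iff (⟨z', rfl⟩ : ({z'} : Set ℂ))).2 hz'
  obtain ⟨t, hzt, ht⟩ := exists_isTranscendenceBasis_superset hi
  obtain ⟨t', hzt', ht'⟩ := exists_isTranscendenceBasis_superset hi'
  have hcard : #t = #t' := ht.cardinalMk_eq ht'
  obtain ⟨f⟩ := Cardinal.eq.1 hcard
  set a : t := ⟨z, hzt (Set.mem_singleton z)⟩ with ha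
  set b : t' := ⟨z', hzt' (Set.mem_singleton z')⟩ with hb
  let e : t ≃ t' := f.trans (Equiv.swap (f a) b)
  have hea : e a = b := by simp [e, Equiv.swap_apply_left]
  letI := IsAlgClosed.isAlgClosure_of_transcendence_basis (R := ℚ) ((↑) : t → ℂ) ht
  letI := IsAlgClosed.isAlgClosure_of_transcendence_basis (R := ℚ) ((↑) : t' → ℂ) ht'
  let e' : Algebra.adjoin ℚ (Set.range ((↑) : t → ℂ)) ≃+*
      Algebra.adjoin ℚ (Set.range ((↑) : t' → ℂ)) :=
    (ht.1.aevalEquiv.symm.trans ((renameEquiv ℚ e).trans ht'.1.aevalEquiv)).toRingEquiv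
  let φ : ℂ ≃+* ℂ := IsAlgClosure.equivOfEquiv ℂ ℂ e'
  refine ⟨φ.toRingHom, ?_⟩
  have hzmem : z ∈ Algebra.adjoin ℚ (Set.range ((↑) : t → ℂ)) :=
    Algebra.subset_adjoin ⟨a, rfl⟩
  have h1 : (φ.toRingHom : ℂ → ℂ) z =
      φ (algebraMap (Algebra.adjoin ℚ (Set.range ((↑) : t → ℂ))) ℂ ⟨z, hzmem⟩) := rfl
  rw [h1, IsAlgClosure.equivOfEquiv_algebraMap]
  have h2 : ht.1.aevalEquiv (X a) = ⟨z, hzmem⟩ := by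
    apply Subtype.ext
    rw [AlgebraicIndependent.aevalEquiv_apply_coe, aeval_X]
  have h3 : e' ⟨z, hzmem⟩ = ht'.1.aevalEquiv (X (e a)) := by
    simp only [e', AlgEquiv.coe_ringEquiv, AlgEquiv.trans_apply]
    rw [← h2, AlgEquiv.symm_apply_apply, renameEquiv_apply, rename_X]
  rw [h3]
  change ((ht'.1.aevalEquiv (X (e a)) : Algebra.adjoin ℚ (Set.range ((↑) : t' → ℂ))) : ℂ) = z'
  rw [AlgebraicIndependent.aevalEquiv_apply_coe, aeval_X, hea]

-- single-conjunct layout: Sub = Summit, duplicated namespace component intended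
set_option linter.dupNamespace false

namespace Summit.ValiantsHypothesis.ValiantsHypothesis.Theorems.AnyonJets

namespace Fibre

open Literature.Computability.AlgebraicComplexity
open Summit.ValiantsHypothesis.ValiantsHypothesis.Theorems.FermionicJetPencilControlsHC

/-! ### Interpolation at an arbitrary point from the nodes `0, …, d` -/

/-- **Evaluation at any point is a fixed linear combination of the node values.** Over a field of
characteristic zero, if `f ∈ k[T, X_σ]` (`T = X none`) has `T`-degree `≤ d`, then for every `a : k`
there are weights `γ` with `f(a, X) = ∑_{u ≤ d} γ_u · f(u, X)` (expand `f(a, X) = ∑_m [T^m] f · a^m`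
and use the inverse-Vandermonde expression of each coefficient,
`coeff_optionEquivLeft_eq_sum_smul_aeval`). [folklore] -/
theorem aeval_optionElim_eq_sum_smul_nodes {k : Type*} [Field k] [CharZero k] {σ : Type*}
    (f : MvPolynomial (Option σ) k) {d : ℕ} (hd : (optionEquivLeft k σ f).natDegree ≤ d) (a : k) :
    ∃ γ : Fin (d + 1) → k, aeval (fun o : Option σ => o.elim (C a) X) f =
      ∑ u : Fin (d + 1), γ u • aeval (fun o : Option σ => o.elim (C ((u : ℕ) : k)) X) f := by
  classical
  choose β hβ using fun m : ℕ => exists_interpolation_weights (k := k) d m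
  refine ⟨fun u => ∑ m ∈ Finset.range (d + 1), β m u * a ^ m, ?_⟩
  set p := optionEquivLeft k σ f with hp
  have hlt : p.natDegree < d + 1 := Nat.lt_succ_of_le hd
  rw [aeval_optionElim_eq_eval_optionEquivLeft, ← hp, Polynomial.eval_eq_sum_range' hlt]
  have hcoeff : ∀ m, p.coeff m =
      ∑ u : Fin (d + 1), β m u • aeval (fun o : Option σ => o.elim (C ((u : ℕ) : k)) X) f :=
    fun m => coeff_optionEquivLeft_eq_sum_smul_aeval f hd m (hβ m)
  simp_rw [hcoeff, Finset.sum_mul, Finset.sum_smul]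
  rw [Finset.sum_comm]
  refine Finset.sum_congr rfl fun u _ => Finset.sum_congr rfl fun m _ => ?_
  rw [smul_eq_C_mul, smul_eq_C_mul, map_mul, map_pow]
  ring

/-! ### The fibres of the inversion pencil -/

variable (z : ℂ) (n : ℕ)

/-- The pencil `∑_σ (z + T)^{inv σ} ∏ᵢ X_{σ i, i}` at the node `T = u` is the fibre `P_n(z + u; X)`.
[folklore] -/
theorem aeval_node_pencilAt (u : ℂ) :
    aeval (fun o : Option (Fin n × Fin n) => o.elim (C u) X)
      (∑ σ : Equiv.Perm (Fin n), (C z + X none) ^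
          (Finset.univ.filter (fun p : Fin n × Fin n => p.1 < p.2 ∧ σ p.2 < σ p.1)).card *
        ∏ i : Fin n, X (some (σ i, i)) : MvPolynomial (Option (Fin n × Fin n)) ℂ) =
      ∑ σ : Equiv.Perm (Fin n), C ((z + u) ^
          (Finset.univ.filter (fun p : Fin n × Fin n => p.1 < p.2 ∧ σ p.2 < σ p.1)).card) *
        ∏ i : Fin n, X (σ i, i) := by
  simp only [map_sum, map_mul, map_pow, map_prod, map_add, aeval_C, aeval_X, Option.elim_none,
    Option.elim_some, MvPolynomial.algebraMap_eq]

/-- At `T = 1 - z` the pencil `∑_σ (z + T)^{inv σ} x^σ` is the permanent. [folklore] -/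
theorem aeval_one_sub_pencilAt :
    aeval (fun o : Option (Fin n × Fin n) => o.elim (C (1 - z)) X)
      (∑ σ : Equiv.Perm (Fin n), (C z + X none) ^
          (Finset.univ.filter (fun p : Fin n × Fin n => p.1 < p.2 ∧ σ p.2 < σ p.1)).card *
        ∏ i : Fin n, X (some (σ i, i)) : MvPolynomial (Option (Fin n × Fin n)) ℂ) =
      perPoly (Fin n) ℂ := by
  rw [aeval_node_pencilAt, perPoly, Matrix.permanent]
  refine Finset.sum_congr rfl fun σ _ => ?_
  rw [add_sub_cancel, one_pow, C_1, one_mul]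
  rfl

/-- The pencil `∑_σ (z + T)^{inv σ} x^σ` has `T`-degree `≤ n²` (crudely: `inv σ ≤ #(Fin n × Fin n)`).
[folklore] -/
theorem natDegree_pencilAt_le :
    (optionEquivLeft ℂ (Fin n × Fin n)
      (∑ σ : Equiv.Perm (Fin n), (C z + X none) ^
          (Finset.univ.filter (fun p : Fin n × Fin n => p.1 < p.2 ∧ σ p.2 < σ p.1)).card *
        ∏ i : Fin n, X (some (σ i, i)) : MvPolynomial (Option (Fin n × Fin n)) ℂ)).natDegree ≤
      n * n := by
  simp only [map_sum, map_mul, map_pow, map_prod, map_add, optionEquivLeft_C, optionEquivLeft_X_none,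
    optionEquivLeft_X_some]
  refine Polynomial.natDegree_sum_le_of_forall_le _ _ fun σ _ => ?_
  refine Polynomial.natDegree_mul_le.trans ?_
  have h0 : (∏ i : Fin n, Polynomial.C (X (σ i, i) : MvPolynomial (Fin n × Fin n) ℂ)).natDegree = 0 := by
    rw [← map_prod, Polynomial.natDegree_C]
  rw [h0, add_zero]
  refine Polynomial.natDegree_pow_le.trans ?_
  have h1 : (Polynomial.C (C z) + Polynomial.X :
      Polynomial (MvPolynomial (Fin n × Fin n) ℂ)).natDegree ≤ 1 :=
    (Polynomial.natDegree_add_le _ _).trans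
      (max_le (by rw [Polynomial.natDegree_C]; exact Nat.zero_le _) Polynomial.natDegree_X_le)
  have hcard : (Finset.univ.filter (fun p : Fin n × Fin n => p.1 < p.2 ∧ σ p.2 < σ p.1)).card ≤ n * n :=
    (Finset.card_filter_le _ _).trans (by simp)
  exact (Nat.mul_le_mul hcard h1).trans (le_of_eq (mul_one _))

variable {z}

/-- **All transcendental fibres are equally easy**: for transcendental `z` and `u ∈ ℕ`,
`L(P_n(z + u; X)) ≤ L(P_n(z; X))` — map a minimal circuit along a ring endomorphism `φ` of `ℂ` with
`φ z = z + u` (`Complex.exists_ringHom_apply_eq_of_transcendental`, `complexity_map_le`).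
[cite: Burgisser2000, §4.1 (extension of scalars)] -/
theorem complexity_fibre_add_nat_le (hz : Transcendental ℚ z) (u : ℕ) :
    complexity (∑ σ : Equiv.Perm (Fin n), C ((z + u) ^
          (Finset.univ.filter (fun p : Fin n × Fin n => p.1 < p.2 ∧ σ p.2 < σ p.1)).card) *
        ∏ i : Fin n, X (σ i, i) : MvPolynomial (Fin n × Fin n) ℂ) ≤
      complexity (∑ σ : Equiv.Perm (Fin n), C (z ^
          (Finset.univ.filter (fun p : Fin n × Fin n => p.1 < p.2 ∧ σ p.2 < σ p.1)).card) *
        ∏ i : Fin n, X (σ i, i) : MvPolynomial (Fin n × Fin n) ℂ) := by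
  -- `z + u` is transcendental
  have hzu : Transcendental ℚ (z + u) := by
    have hf : (Polynomial.X + Polynomial.C (u : ℚ)).natDegree ≠ 0 := by
      rw [Polynomial.natDegree_X_add_C]; exact one_ne_zero
    have hf' : (Polynomial.X + Polynomial.C (u : ℚ)).leadingCoeff ∈ nonZeroDivisors ℚ := by
      rw [Polynomial.leadingCoeff_X_add_C]; exact mem_nonZeroDivisors_of_ne_zero one_ne_zero
    have h := hz.aeval (Polynomial.X + Polynomial.C (u : ℚ)) hf hf'
    simpa using h
  obtain ⟨φ, hφ⟩ := Complex.exists_ringHom_apply_eq_of_transcendental hz hzu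
  have hmap : MvPolynomial.map φ (∑ σ : Equiv.Perm (Fin n), C (z ^
          (Finset.univ.filter (fun p : Fin n × Fin n => p.1 < p.2 ∧ σ p.2 < σ p.1)).card) *
        ∏ i : Fin n, X (σ i, i) : MvPolynomial (Fin n × Fin n) ℂ) =
      ∑ σ : Equiv.Perm (Fin n), C ((z + u) ^
          (Finset.univ.filter (fun p : Fin n × Fin n => p.1 < p.2 ∧ σ p.2 < σ p.1)).card) *
        ∏ i : Fin n, X (σ i, i) := by
    simp only [map_sum, map_mul, map_C, map_pow, map_prod, map_X, hφ]
  rw [← hmap]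
  exact ArithCircuit.complexity_map_le φ _

/-- **The permanent from `D + 1` transcendental fibres**: for transcendental `z`,
`L(per_n) ≤ (D+1)(L(P_n(z;X)) + 1) + (D+1)` with `D = n²` — interpolate the pencil
`∑_σ (z+T)^{inv σ} x^σ` at `T = 1 - z` from the nodes `T = 0, …, D`, whose values are the fibres
`P_n(z+u; X)`, each as cheap as `P_n(z; X)`. [cite: Burgisser2000, §2.1] -/
theorem complexity_perPoly_le_of_fibre (hz : Transcendental ℚ z) :
    complexity (perPoly (Fin n) ℂ) ≤
      (n * n + 1) * (complexity (∑ σ : Equiv.Perm (Fin n), C (z ^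
          (Finset.univ.filter (fun p : Fin n × Fin n => p.1 < p.2 ∧ σ p.2 < σ p.1)).card) *
        ∏ i : Fin n, X (σ i, i) : MvPolynomial (Fin n × Fin n) ℂ) + 1) + (n * n + 1) := by
  obtain ⟨γ, hγ⟩ := aeval_optionElim_eq_sum_smul_nodes _ (natDegree_pencilAt_le z n) (1 - z)
  rw [aeval_one_sub_pencilAt] at hγ
  rw [hγ]
  have h := complexity_sum_le_of_le (Finset.univ : Finset (Fin (n * n + 1)))
    (fun u => γ u • aeval (fun o : Option (Fin n × Fin n) => o.elim (C ((u : ℕ) : ℂ)) X)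
      (∑ σ : Equiv.Perm (Fin n), (C z + X none) ^
          (Finset.univ.filter (fun p : Fin n × Fin n => p.1 < p.2 ∧ σ p.2 < σ p.1)).card *
        ∏ i : Fin n, X (some (σ i, i)) : MvPolynomial (Option (Fin n × Fin n)) ℂ))
    (complexity (∑ σ : Equiv.Perm (Fin n), C (z ^
          (Finset.univ.filter (fun p : Fin n × Fin n => p.1 < p.2 ∧ σ p.2 < σ p.1)).card) *
        ∏ i : Fin n, X (σ i, i) : MvPolynomial (Fin n × Fin n) ℂ) + 1) fun u _ => by
      refine (complexity_smul_le_holds _ _).trans (Nat.add_le_add_right ?_ 1)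
      rw [aeval_node_pencilAt]
      exact complexity_fibre_add_nat_le n hz u
  simpa only [Finset.card_univ, Fintype.card_fin] using h

end Fibre

open Literature.Computability.AlgebraicComplexity

/-- **Settles `stmt-ValiantsHypothesis-16748` (support `TranscendentalFibre`, route AnyonJets).**
For transcendental `z`, if the fibre `(P_n(z; X))_n = (∑_σ z^{inv σ} ∏ᵢ X_{σ i, i})_n` of the
inversion pencil is a `VP` family over `ℂ`, then so is the permanent: `per` is a p-family
(`isPFamily_perPoly_holds`) and `L(per_n) ≤ (D+1)(L(P_n(z;X)) + 1) + (D+1)`, `D = n²`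
(`Fibre.complexity_perPoly_le_of_fibre`: transitivity of `End(ℂ)` on transcendentals +
interpolation). [folklore] -/
theorem transcendentalFibre_proof :
    Summit.ValiantsHypothesis.ValiantsHypothesis.Theses.AnyonJets.TranscendentalFibre := by
  dsimp only [Summit.ValiantsHypothesis.ValiantsHypothesis.Theses.AnyonJets.TranscendentalFibre]
  intro z hz hVP
  refine ⟨isPFamily_perPoly_holds, ?_⟩
  have hL : IsPBounded fun n => complexity (∑ σ : Equiv.Perm (Fin n), C (z ^
          (Finset.univ.filter (fun p : Fin n × Fin n => p.1 < p.2 ∧ σ p.2 < σ p.1)).card) *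
        ∏ i : Fin n, X (σ i, i) : MvPolynomial (Fin n × Fin n) ℂ) := hVP.2
  have hD : IsPBounded fun n : ℕ => n * n + 1 := by
    refine ⟨2, fun n => ?_⟩
    show n * n + 1 ≤ n ^ 2 + 2
    rw [sq]; omega
  exact (IsPBounded.add_holds (IsPBounded.mul_holds hD (IsPBounded.add_holds hL (IsPBounded.const 1)))
    hD).mono fun n => Fibre.complexity_perPoly_le_of_fibre n hz

end Summit.ValiantsHypothesis.ValiantsHypothesis.Theorems.AnyonJets

end
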